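import Summits.CriticalPhenomena.PercolationContinuityZ3.Theorems.PercNearOneGluingNoHeavyLowerTailSahiOneStepAndPair
import Summits.CriticalPhenomena.PercolationContinuityZ3.Theorems.PercNearOneGluingNoHeavyLowerTailSahiOneStepUniformThreshold
import HarnessLib

/-!
# One-step scheme: LITERAL STEPS for `(2′)` — a common top-level literal `e` of both events reduces `(2′)` to the sections

Prover prim-ineq-prove-3 gen 25 (`--supports stmt-CriticalPhenomena-4575`; memo
`run/shared/lean/prim/prim-ineq-prove-3/FINDING-G25-DECOUPLING.md` §0, §4).  No definitions, no named facts, no sorries, no `native_decide`.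

Hypothesis `(2′)` (`0 ≤ n = osN`) for the Hamming-threshold slot `{N_{insert e F} ≥ t+1}` (`e ∉ F`) and a pair of increasing events in which
the coordinate `e` enters BOTH events as a TOP-LEVEL LITERAL — `{e ∈ ω} ∩ X` ("AND") or `{e ∈ ω} ∪ X` ("OR") with `X` not depending on `e`.
By the pivot identity along `e` (`…SahiOneStepThresholdStep.osN_ind_ind_nonneg_of_step`) the `e`-sections are `X` and a constant event, and
the step form `M₂` is signed by Harris / inclusion–exclusion alone:
* `osN_threshold_andStep`  — AND/AND: `(2′)` for `({e}∧A₁, {e}∧B₁)` at level `t+1` on `insert e F` ⟸ `(2′)` for `(A₁, B₁)` at level `t` on `F`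
  (`M₂ ≥ μH⁰(1−μH¹)μA₁μB₁ ≥ 0` by Harris twice);
* `osN_threshold_orStep`   — OR/OR: `(2′)` for `({e}∨A₀, {e}∨B₀)` at level `t+1` on `insert e F` ⟸ `(2′)` for `(A₀, B₀)` at level `t+1` on `F`
  (`M₂ = (1−μH¹)·μ(H⁰ ∖ (A₀ ∪ B₀)) ≥ 0` by inclusion–exclusion);
* `osN_threshold_andOr_nonneg` — AND/OR: `(2′)` for `({e}∧A₁, {e}∨B₀)` holds UNCONDITIONALLY for all increasing `A₁` and ALL events `B₀`
  not depending on `e` (both section terms vanish; `M₂ = (1−μH¹)μA₁(1−μB₀) − μ(A₁∖H¹)·μ(H⁰ᶜ∖B₀) ≥ 0` by Harris), with the Kahn C5 / Sahi `C₃` corollary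
  `sahiE3_threshold_andOr_nonneg`.
Iterating the first two from the disjoint-support base (`…SahiOneStepDisjointSupport`) gives `(2′)` for all pairs
`(x_K ∧ (x_O ∨ A′), x_K ∧ (x_O ∨ B′))`, … with `A′, B′` disjointly supported.
-/

noncomputable section

namespace Summit.CriticalPhenomena.PercolationContinuityZ3.Theorems

namespace SahiOneStep

open MeasureTheory Finset
open Literature.Probability.Percolation (DeterminedBy determinedBy_iff)
open Literature.Probability.LatticeModels (prodBernoulli sahiE3 prodBernoulli_harris)
open Literature.Probability.Percolation.DecisionTree (ind)
open scoped Classical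

variable {ι : Type*} [Fintype ι]

omit [Fintype ι] in
/-- An event determined by coordinates avoiding `e` is unchanged by deleting `e`. [folklore] -/
theorem sdiff_mem_iff_of_determinedBy {A : Set (Set ι)} {S : Finset ι} (hAS : DeterminedBy A (↑S : Set ι)) {e : ι}
    (he : e ∉ S) (ω : Set ι) : ω \ {e} ∈ A ↔ ω ∈ A := by
  refine (determinedBy_iff A _).1 hAS (ω \ {e}) ω ?_
  ext i
  simp only [Set.mem_inter_iff, Set.mem_sdiff, Set.mem_singleton_iff, Finset.mem_coe]
  constructor
  · rintro ⟨⟨h, _⟩, hi⟩; exact ⟨h, hi⟩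
  · rintro ⟨h, hi⟩; exact ⟨⟨h, fun hie => he (hie ▸ hi)⟩, hi⟩

/-! ## Sections of literal events -/

omit [Fintype ι] in
/-- `insert e`-section of `{e ∈ ω} ∩ A` is `A`. [folklore] -/
theorem section_insert_and {A : Set (Set ι)} {S : Finset ι} (hAS : DeterminedBy A (↑S : Set ι)) {e : ι} (he : e ∉ S) :
    {ω : Set ι | insert e ω ∈ ({ω : Set ι | e ∈ ω} ∩ A)} = A := by
  ext ω
  simp only [Set.mem_setOf_eq, Set.mem_inter_iff, Set.mem_insert_iff, true_or, true_and]
  exact mem_iff_insert_mem_of_determinedBy hAS he ω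

omit [Fintype ι] in
/-- `∖ {e}`-section of `{e ∈ ω} ∩ A` is empty. [folklore] -/
theorem section_sdiff_and (A : Set (Set ι)) (e : ι) :
    {ω : Set ι | ω \ {e} ∈ ({ω : Set ι | e ∈ ω} ∩ A)} = ∅ := by
  ext ω
  simp only [Set.mem_setOf_eq, Set.mem_inter_iff, Set.mem_sdiff, Set.mem_singleton_iff, not_true_eq_false, and_false,
    false_and, Set.mem_empty_iff_false]

omit [Fintype ι] in
/-- `insert e`-section of `{e ∈ ω} ∪ A` is everything. [folklore] -/
theorem section_insert_or (A : Set (Set ι)) (e : ι) :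
    {ω : Set ι | insert e ω ∈ ({ω : Set ι | e ∈ ω} ∪ A)} = Set.univ := by
  ext ω
  simp only [Set.mem_setOf_eq, Set.mem_union, Set.mem_insert_iff, true_or, Set.mem_univ]

omit [Fintype ι] in
/-- `∖ {e}`-section of `{e ∈ ω} ∪ A` is `A`. [folklore] -/
theorem section_sdiff_or {A : Set (Set ι)} {S : Finset ι} (hAS : DeterminedBy A (↑S : Set ι)) {e : ι} (he : e ∉ S) :
    {ω : Set ι | ω \ {e} ∈ ({ω : Set ι | e ∈ ω} ∪ A)} = A := by
  ext ω
  simp only [Set.mem_setOf_eq, Set.mem_union, Set.mem_sdiff, Set.mem_singleton_iff, not_true_eq_false, and_false, false_or]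
  exact sdiff_mem_iff_of_determinedBy hAS he ω

/-- `n` vanishes when the second event is everything. [this work] -/
theorem osN_ind_ind_univ_snd (p : ι → unitInterval) (H A : Set (Set ι)) :
    osN p H (ind A) (ind (Set.univ : Set (Set ι))) = 0 := by
  rw [osN_ind_ind, Set.inter_univ, Set.inter_univ, probReal_univ]; ring

/-! ## The three literal steps -/

/-- **AND/AND STEP.**  `(2′)` for `({e∈ω}∩A₁, {e∈ω}∩B₁)` with slot `{N_{insert e F} ≥ t+1}` follows from `(2′)` for `(A₁, B₁)` with slot
`{N_F ≥ t}` (all increasing `A₁, B₁` not depending on `e`). [this work] -/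
theorem osN_threshold_andStep (p : ι → unitInterval) {F : Finset ι} {e : ι} (he : e ∉ F) (t : ℕ)
    {A B : Set (Set ι)} (hA : IsUpperSet A) (hB : IsUpperSet B) {SA SB : Finset ι}
    (hAS : DeterminedBy A (↑SA : Set ι)) (hBS : DeterminedBy B (↑SB : Set ι)) (heA : e ∉ SA) (heB : e ∉ SB)
    (hsec : 0 ≤ osN p {ω : Set ι | t ≤ (F.filter (· ∈ ω)).card} (ind A) (ind B)) :
    0 ≤ osN p {ω : Set ι | t + 1 ≤ ((insert e F).filter (· ∈ ω)).card}
      (ind ({ω : Set ι | e ∈ ω} ∩ A)) (ind ({ω : Set ι | e ∈ ω} ∩ B)) := by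
  have sH1 : {ω : Set ι | insert e ω ∈ {ω : Set ι | t + 1 ≤ ((insert e F).filter (· ∈ ω)).card}} =
      {ω : Set ι | t ≤ (F.filter (· ∈ ω)).card} := section_insert_threshold he t
  have sH0 : {ω : Set ι | ω \ {e} ∈ {ω : Set ι | t + 1 ≤ ((insert e F).filter (· ∈ ω)).card}} =
      {ω : Set ι | t + 1 ≤ (F.filter (· ∈ ω)).card} := section_sdiff_threshold he t
  set H1 : Set (Set ι) := {ω : Set ι | t ≤ (F.filter (· ∈ ω)).card} with hH1
  set H0 : Set (Set ι) := {ω : Set ι | t + 1 ≤ (F.filter (· ∈ ω)).card} with hH0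
  have hH01 : H0 ⊆ H1 := fun ω hω => by
    simp only [hH0, hH1, Set.mem_setOf_eq] at hω ⊢; omega
  have mH : (prodBernoulli p).real H0 ≤ (prodBernoulli p).real H1 := measureReal_mono hH01
  have mH1le : (prodBernoulli p).real H1 ≤ 1 := measureReal_le_one
  have mH0 : 0 ≤ (prodBernoulli p).real H0 := measureReal_nonneg
  have mA0 : 0 ≤ (prodBernoulli p).real A := measureReal_nonneg
  have mB0 : 0 ≤ (prodBernoulli p).real B := measureReal_nonneg
  have harrisAB : (prodBernoulli p).real A * (prodBernoulli p).real B ≤ (prodBernoulli p).real (A ∩ B) :=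
    prodBernoulli_harris p hA hB MeasurableSet.of_discrete MeasurableSet.of_discrete
  have harrisH : (prodBernoulli p).real H1 * (prodBernoulli p).real (A ∩ B) ≤ (prodBernoulli p).real (H1 ∩ (A ∩ B)) :=
    prodBernoulli_harris p (isUpperSet_threshold F t) (hA.inter hB) MeasurableSet.of_discrete MeasurableSet.of_discrete
  have e3 : (prodBernoulli p).real (H1 ∩ (A ∩ B)) = (prodBernoulli p).real (H1 ∩ A ∩ B) := by rw [Set.inter_assoc]
  have mH10 : 0 ≤ (prodBernoulli p).real H1 := measureReal_nonneg
  refine osN_ind_ind_nonneg_of_step p {ω : Set ι | t + 1 ≤ ((insert e F).filter (· ∈ ω)).card}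
    ({ω : Set ι | e ∈ ω} ∩ A) ({ω : Set ι | e ∈ ω} ∩ B) e ?_ ?_ ?_ ?_ ?_ ?_
  · rw [sH1, section_insert_and hAS heA, section_insert_and hBS heB]; exact hsec
  · rw [sH0, section_sdiff_and, section_sdiff_and, osN_ind_ind]; simp
  · rw [sH1, sH0, section_insert_and hAS heA, section_insert_and hBS heB, section_sdiff_and, section_sdiff_and]
    simp only [Set.inter_empty, measureReal_empty, sub_zero, mul_zero, zero_mul, add_zero, zero_add]
    rw [← e3]
    have h1 : 0 ≤ (prodBernoulli p).real H0 * (1 - (prodBernoulli p).real H1) * ((prodBernoulli p).real A * (prodBernoulli p).real B) :=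
      mul_nonneg (mul_nonneg mH0 (sub_nonneg.2 mH1le)) (mul_nonneg mA0 mB0)
    have h2 : (prodBernoulli p).real H1 * ((prodBernoulli p).real A * (prodBernoulli p).real B) ≤
        (prodBernoulli p).real (H1 ∩ (A ∩ B)) := (mul_le_mul_of_nonneg_left harrisAB mH10).trans harrisH
    nlinarith [h1, h2, mul_nonneg mA0 mB0, mH, harrisAB]
  · rw [sH1, sH0]; exact mH
  · rw [section_insert_and hAS heA, section_sdiff_and, measureReal_empty]; exact mA0
  · rw [section_insert_and hBS heB, section_sdiff_and, measureReal_empty]; exact mB0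

/-- **OR/OR STEP.**  `(2′)` for `({e∈ω}∪A₀, {e∈ω}∪B₀)` with slot `{N_{insert e F} ≥ t+1}` follows from `(2′)` for `(A₀, B₀)` with slot
`{N_F ≥ t+1}` (all increasing `A₀, B₀` not depending on `e`). [this work] -/
theorem osN_threshold_orStep (p : ι → unitInterval) {F : Finset ι} {e : ι} (he : e ∉ F) (t : ℕ)
    {A B : Set (Set ι)} {SA SB : Finset ι}
    (hAS : DeterminedBy A (↑SA : Set ι)) (hBS : DeterminedBy B (↑SB : Set ι)) (heA : e ∉ SA) (heB : e ∉ SB)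
    (hsec : 0 ≤ osN p {ω : Set ι | t + 1 ≤ (F.filter (· ∈ ω)).card} (ind A) (ind B)) :
    0 ≤ osN p {ω : Set ι | t + 1 ≤ ((insert e F).filter (· ∈ ω)).card}
      (ind ({ω : Set ι | e ∈ ω} ∪ A)) (ind ({ω : Set ι | e ∈ ω} ∪ B)) := by
  have sH1 : {ω : Set ι | insert e ω ∈ {ω : Set ι | t + 1 ≤ ((insert e F).filter (· ∈ ω)).card}} =
      {ω : Set ι | t ≤ (F.filter (· ∈ ω)).card} := section_insert_threshold he t
  have sH0 : {ω : Set ι | ω \ {e} ∈ {ω : Set ι | t + 1 ≤ ((insert e F).filter (· ∈ ω)).card}} =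
      {ω : Set ι | t + 1 ≤ (F.filter (· ∈ ω)).card} := section_sdiff_threshold he t
  set H1 : Set (Set ι) := {ω : Set ι | t ≤ (F.filter (· ∈ ω)).card} with hH1
  set H0 : Set (Set ι) := {ω : Set ι | t + 1 ≤ (F.filter (· ∈ ω)).card} with hH0
  have hH01 : H0 ⊆ H1 := fun ω hω => by
    simp only [hH0, hH1, Set.mem_setOf_eq] at hω ⊢; omega
  have mH : (prodBernoulli p).real H0 ≤ (prodBernoulli p).real H1 := measureReal_mono hH01
  have mH1le : (prodBernoulli p).real H1 ≤ 1 := measureReal_le_one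
  have mAle : (prodBernoulli p).real A ≤ 1 := measureReal_le_one
  have mBle : (prodBernoulli p).real B ≤ 1 := measureReal_le_one
  -- inclusion–exclusion inside `H0`
  have hIE : (prodBernoulli p).real (H0 ∩ A) + (prodBernoulli p).real (H0 ∩ B) - (prodBernoulli p).real (H0 ∩ A ∩ B) ≤
      (prodBernoulli p).real H0 := by
    have hu := measureReal_union_add_inter (μ := prodBernoulli p) (s := H0 ∩ A) (MeasurableSet.of_discrete (s := H0 ∩ B))
    have hi : (H0 ∩ A) ∩ (H0 ∩ B) = H0 ∩ A ∩ B := by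
      ext ω; simp only [Set.mem_inter_iff]; tauto
    rw [hi] at hu
    have hsub : (prodBernoulli p).real ((H0 ∩ A) ∪ (H0 ∩ B)) ≤ (prodBernoulli p).real H0 :=
      measureReal_mono (Set.union_subset Set.inter_subset_left Set.inter_subset_left)
    linarith
  refine osN_ind_ind_nonneg_of_step p {ω : Set ι | t + 1 ≤ ((insert e F).filter (· ∈ ω)).card}
    ({ω : Set ι | e ∈ ω} ∪ A) ({ω : Set ι | e ∈ ω} ∪ B) e ?_ ?_ ?_ ?_ ?_ ?_
  · rw [sH1, section_insert_or, section_insert_or, osN_ind_ind_univ_left]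
  · rw [sH0, section_sdiff_or hAS heA, section_sdiff_or hBS heB]; exact hsec
  · rw [sH1, sH0, section_insert_or, section_insert_or, section_sdiff_or hAS heA, section_sdiff_or hBS heB]
    simp only [Set.inter_univ, probReal_univ, mul_one]
    nlinarith [hIE, mH1le, mH]
  · rw [sH1, sH0]; exact mH
  · rw [section_insert_or, section_sdiff_or hAS heA, probReal_univ]; exact mAle
  · rw [section_insert_or, section_sdiff_or hBS heB, probReal_univ]; exact mBle

/-- **AND/OR PAIRS (unconditional).**  For all increasing `A₁, B₀` not depending on `e` (arbitrary overlapping supports otherwise):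
`(2′)` holds for `({e∈ω}∩A₁, {e∈ω}∪B₀)` with slot `{N_{insert e F} ≥ t+1}`. [this work] -/
theorem osN_threshold_andOr_nonneg (p : ι → unitInterval) {F : Finset ι} {e : ι} (he : e ∉ F) (t : ℕ)
    {A B : Set (Set ι)} (hA : IsUpperSet A) {SA SB : Finset ι}
    (hAS : DeterminedBy A (↑SA : Set ι)) (hBS : DeterminedBy B (↑SB : Set ι)) (heA : e ∉ SA) (heB : e ∉ SB) :
    0 ≤ osN p {ω : Set ι | t + 1 ≤ ((insert e F).filter (· ∈ ω)).card}
      (ind ({ω : Set ι | e ∈ ω} ∩ A)) (ind ({ω : Set ι | e ∈ ω} ∪ B)) := by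
  have sH1 : {ω : Set ι | insert e ω ∈ {ω : Set ι | t + 1 ≤ ((insert e F).filter (· ∈ ω)).card}} =
      {ω : Set ι | t ≤ (F.filter (· ∈ ω)).card} := section_insert_threshold he t
  have sH0 : {ω : Set ι | ω \ {e} ∈ {ω : Set ι | t + 1 ≤ ((insert e F).filter (· ∈ ω)).card}} =
      {ω : Set ι | t + 1 ≤ (F.filter (· ∈ ω)).card} := section_sdiff_threshold he t
  set H1 : Set (Set ι) := {ω : Set ι | t ≤ (F.filter (· ∈ ω)).card} with hH1
  set H0 : Set (Set ι) := {ω : Set ι | t + 1 ≤ (F.filter (· ∈ ω)).card} with hH0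
  have hH01 : H0 ⊆ H1 := fun ω hω => by
    simp only [hH0, hH1, Set.mem_setOf_eq] at hω ⊢; omega
  have mH : (prodBernoulli p).real H0 ≤ (prodBernoulli p).real H1 := measureReal_mono hH01
  have mH1le : (prodBernoulli p).real H1 ≤ 1 := measureReal_le_one
  have mH0 : 0 ≤ (prodBernoulli p).real H0 := measureReal_nonneg
  have mA0 : 0 ≤ (prodBernoulli p).real A := measureReal_nonneg
  have mBle : (prodBernoulli p).real B ≤ 1 := measureReal_le_one
  -- `λ = μA − μ(H1∩A) ≤ μA(1−μH1)` (Harris) and `(1−μH0) − (μB − μ(H0∩B)) ≤ 1 − μB` (monotonicity)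
  have harrisHA : (prodBernoulli p).real H1 * (prodBernoulli p).real A ≤ (prodBernoulli p).real (H1 ∩ A) :=
    prodBernoulli_harris p (isUpperSet_threshold F t) hA MeasurableSet.of_discrete MeasurableSet.of_discrete
  have hHA_le : (prodBernoulli p).real (H1 ∩ A) ≤ (prodBernoulli p).real A := measureReal_mono Set.inter_subset_right
  have hHB_le : (prodBernoulli p).real (H0 ∩ B) ≤ (prodBernoulli p).real B := measureReal_mono Set.inter_subset_right
  have hHB_le' : (prodBernoulli p).real (H0 ∩ B) ≤ (prodBernoulli p).real H0 := measureReal_mono Set.inter_subset_left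
  -- `μB − μ(H0∩B) ≤ 1 − μH0`: `B ∖ H0 ⊆ H0ᶜ`
  have hκ : (prodBernoulli p).real B - (prodBernoulli p).real (H0 ∩ B) ≤ 1 - (prodBernoulli p).real H0 := by
    have hu := measureReal_union_add_inter (μ := prodBernoulli p) (s := H0) (MeasurableSet.of_discrete (s := B))
    have hle : (prodBernoulli p).real (H0 ∪ B) ≤ 1 := measureReal_le_one
    linarith
  refine osN_ind_ind_nonneg_of_step p {ω : Set ι | t + 1 ≤ ((insert e F).filter (· ∈ ω)).card}
    ({ω : Set ι | e ∈ ω} ∩ A) ({ω : Set ι | e ∈ ω} ∪ B) e ?_ ?_ ?_ ?_ ?_ ?_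
  · rw [sH1, section_insert_and hAS heA, section_insert_or, osN_ind_ind_univ_snd]
  · rw [sH0, section_sdiff_and, section_sdiff_or hBS heB, osN_ind_ind]; simp
  · rw [sH1, sH0, section_insert_and hAS heA, section_insert_or, section_sdiff_and, section_sdiff_or hBS heB]
    simp only [Set.inter_empty, Set.empty_inter, Set.inter_univ, measureReal_empty, probReal_univ, sub_zero, zero_mul,
      add_zero, mul_one]
    -- goal: 0 ≤ (μA − μ(H1∩A))(μB − μ(H0∩B)) + (1−μH0)μ(H1∩A) − (μH1−μH0)μA − (1−μH1)(μA μB)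
    have hprod : ((prodBernoulli p).real A - (prodBernoulli p).real (H1 ∩ A)) *
        ((1 - (prodBernoulli p).real H0) - ((prodBernoulli p).real B - (prodBernoulli p).real (H0 ∩ B))) ≤
        ((prodBernoulli p).real A * (1 - (prodBernoulli p).real H1)) * (1 - (prodBernoulli p).real B) :=
      mul_le_mul (by nlinarith [harrisHA]) (by linarith [hHB_le]) (by linarith [hκ]) (by nlinarith [mA0, mH1le])
    linarith [hprod]
  · rw [sH1, sH0]; exact mH
  · rw [section_insert_and hAS heA, section_sdiff_and, measureReal_empty]; exact mA0
  · rw [section_insert_or, section_sdiff_or hBS heB, probReal_univ]; exact mBle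

/-- **KAHN C5 / SAHI `C₃` FOR AND/OR PAIRS**: `0 ≤ E₃(1_{N_{insert e F} ≥ t+1}, 1_{{e∈ω}∩A₁}, 1_{{e∈ω}∪B₀})` for all increasing `A₁, B₀`
not depending on `e`. [this work] -/
theorem sahiE3_threshold_andOr_nonneg (p : ι → unitInterval) {F : Finset ι} {e : ι} (he : e ∉ F) (t : ℕ)
    {A B : Set (Set ι)} (hA : IsUpperSet A) (hB : IsUpperSet B) {SA SB : Finset ι}
    (hAS : DeterminedBy A (↑SA : Set ι)) (hBS : DeterminedBy B (↑SB : Set ι)) (heA : e ∉ SA) (heB : e ∉ SB) :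
    0 ≤ sahiE3 (prodBernoulli p) {ω : Set ι | t + 1 ≤ ((insert e F).filter (· ∈ ω)).card}
      ({ω : Set ι | e ∈ ω} ∩ A) ({ω : Set ι | e ∈ ω} ∪ B) := by
  have heU : IsUpperSet {ω : Set ι | e ∈ ω} := fun ω ω' hle hω => hle hω
  rw [← osT_ind_ind, osT_eq_osMp_add_osN]
  exact add_nonneg (osMp_threshold_nonneg_all p (insert e F) (t + 1) (heU.inter hA) (heU.union hB))
    (osN_threshold_andOr_nonneg p he t hA hAS hBS heA heB)

end SahiOneStep

end Summit.CriticalPhenomena.PercolationContinuityZ3.Theorems
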